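import Mathlib
import Summits.Ventures.PercRepro2.CoinChainAWorldLemmas

/-!
# The pure AND-switch chain with a nonnegative A-law covariance — the numeric form of the
A-world theorem (blind cell PercRepro2, night-2 g19; proofs/NIGHT2-DARC.md §59.9)

Same decomposition as `CoinChainAWorld.lean` (world `A` = «`a` reaches the target in the
head», world `Ā` its complement; the identity (★) at mixing parameter `1/2`), with the
structural hypothesis «`c − d` log-supermodular» replaced by what it is used for: the NUMERIC
hypothesis `hD` that the two markers have nonnegative covariance under the `A`-law
`ν · (1 − θ) · (c − d)`.  Three of the four terms of (★) need nothing; the fourth is `hD`.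
Compare `pureChain_functional_nonneg_of_sameSign` (§58.4: the κ-shift product nonnegative) —
together with the trivial condition «the `R` → gate shift product nonnegative» and the
covering-marker theorem these numeric conditions cover 749 / 750 checks of the exact census of
enumerated heads (mining/night-2/g19/cover2.py); the uncovered instance is the open case.
-/

namespace Summit.Ventures.PercRepro2.Coin

section ChainAWorldCov

variable {V : Type*} [DecidableEq V] {R : Type*} [Field R] [LinearOrder R] [IsStrictOrderedRing R]

/-- **THE PURE AND-SWITCH CHAIN IS NONNEGATIVE AT EVERY COIN PROBABILITY WHEN THE A-LAW HAS
NONNEGATIVE MARKER COVARIANCE.**  The A-world theorem with the structural hypothesis `hcd_lsm`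
replaced by the NUMERIC hypothesis `hD`: the covariance of the two markers under the `A`-law
`ν · (1 − θ) · (c − d)` is nonnegative (in cleared form).  Strictly more general than
`pureChain_functional_nonneg` (FKG gives `hD` from `hcd_lsm`); on the exact census of
enumerated heads `hD` holds in 506 / 750 checks against 153 / 450 for `hcd_lsm`. -/
theorem pureChain_functional_nonneg_of_covA (U ent' : Finset V) (ν c d d' : Finset V → R)
    (ρ : R) (hρ0 : 0 ≤ ρ) (hρ1 : ρ ≤ 1) (hν0 : ∀ W, 0 ≤ ν W)
    (hν : ∀ s ⊆ U, ∀ t ⊆ U, ν s * ν t ≤ ν (s ∩ t) * ν (s ∪ t))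
    (hc0 : ∀ W, 0 ≤ c W) (hd0 : ∀ W, 0 ≤ d W) (hd'0 : ∀ W, 0 ≤ d' W)
    (hdc : ∀ W, d W ≤ c W) (hd'd : ∀ W, d' W ≤ d W)
    (hcc : ∀ s t, c s * c t ≤ c (s ∩ t) * c (s ∪ t))
    (hdd : ∀ s t, d s * d t ≤ d (s ∩ t) * d (s ∪ t))
    (hd'd' : ∀ s t, d' s * d' t ≤ d' (s ∩ t) * d' (s ∪ t))
    (hdd' : ∀ s t, d s * d' t ≤ d (s ∩ t) * d' (s ∪ t))
    (hratio : ∀ s t, s ⊆ t → d s * c t ≤ c s * d t)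
    (hratio' : ∀ s t, s ⊆ t → d' s * c t ≤ c s * d' t)
    (hratio'' : ∀ s t, s ⊆ t → d' s * d t ≤ d s * d' t) (m₁ m₂ : V)
    (hD : (∑ W ∈ U.powerset, ν W * ((1 - chainTheta ∅ ent' ρ W) * (c W - d W)) *
            (if m₁ ∈ W then (1 : R) else 0)) *
          (∑ W ∈ U.powerset, ν W * ((1 - chainTheta ∅ ent' ρ W) * (c W - d W)) *
            (if m₂ ∈ W then (1 : R) else 0)) ≤
        (∑ W ∈ U.powerset, ν W * ((1 - chainTheta ∅ ent' ρ W) * (c W - d W))) *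
          (∑ W ∈ U.powerset, ν W * ((1 - chainTheta ∅ ent' ρ W) * (c W - d W)) *
            ((if m₁ ∈ W then (1 : R) else 0) * (if m₂ ∈ W then (1 : R) else 0)))) :
    0 ≤ (∑ W ∈ U.powerset, ν W * chainMix ∅ ent' ρ c d W) ^ 2 *
          (∑ W ∈ U.powerset, ν W * chainMix ∅ ent' ρ c d' W *
            ((if m₁ ∈ W then (1 : R) else 0) * (if m₂ ∈ W then (1 : R) else 0)))
        - (∑ W ∈ U.powerset, ν W * chainMix ∅ ent' ρ c d W) *
          (∑ W ∈ U.powerset, ν W * chainMix ∅ ent' ρ c d W * (if m₁ ∈ W then (1 : R) else 0)) *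
          (∑ W ∈ U.powerset, ν W * chainMix ∅ ent' ρ c d' W * (if m₂ ∈ W then (1 : R) else 0))
        - (∑ W ∈ U.powerset, ν W * chainMix ∅ ent' ρ c d W) *
          (∑ W ∈ U.powerset, ν W * chainMix ∅ ent' ρ c d W * (if m₂ ∈ W then (1 : R) else 0)) *
          (∑ W ∈ U.powerset, ν W * chainMix ∅ ent' ρ c d' W * (if m₁ ∈ W then (1 : R) else 0))
        + (∑ W ∈ U.powerset, ν W * chainMix ∅ ent' ρ c d W * (if m₁ ∈ W then (1 : R) else 0)) *
          (∑ W ∈ U.powerset, ν W * chainMix ∅ ent' ρ c d W * (if m₂ ∈ W then (1 : R) else 0)) *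
          (∑ W ∈ U.powerset, ν W * chainMix ∅ ent' ρ c d' W) := by
  -- the markers
  have hx0 : ∀ W : Finset V, (0 : R) ≤ (if m₁ ∈ W then (1 : R) else 0) := by
    intro W; split_ifs <;> norm_num
  have hy0 : ∀ W : Finset V, (0 : R) ≤ (if m₂ ∈ W then (1 : R) else 0) := by
    intro W; split_ifs <;> norm_num
  have hx1 : ∀ W : Finset V, (if m₁ ∈ W then (1 : R) else 0) ≤ 1 := by
    intro W; split_ifs <;> norm_num
  have hy1 : ∀ W : Finset V, (if m₂ ∈ W then (1 : R) else 0) ≤ 1 := by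
    intro W; split_ifs <;> norm_num
  have hxm : ∀ s t : Finset V,
      (if m₁ ∈ s then (1 : R) else 0) ≤ (if m₁ ∈ s ∪ t then (1 : R) else 0) := by
    intro s t
    by_cases h : m₁ ∈ s
    · rw [if_pos h, if_pos (Finset.mem_union_left t h)]
    · rw [if_neg h]; split_ifs <;> norm_num
  have hym : ∀ s t : Finset V,
      (if m₂ ∈ s then (1 : R) else 0) ≤ (if m₂ ∈ s ∪ t then (1 : R) else 0) := by
    intro s t
    by_cases h : m₂ ∈ s
    · rw [if_pos h, if_pos (Finset.mem_union_left t h)]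
    · rw [if_neg h]; split_ifs <;> norm_num
  -- the three laws of the decomposition (opaque, with pointwise equations)
  obtain ⟨hθ0, -, -⟩ := one_sub_theta_facts ent' ρ hρ0 hρ1
  obtain ⟨RA, hRA⟩ : ∃ RA : Finset V → R,
      ∀ W, RA W = ν W * ((1 - chainTheta ∅ ent' ρ W) * (c W - d W)) := ⟨_, fun _ => rfl⟩
  obtain ⟨RB, hRB⟩ : ∃ RB : Finset V → R, ∀ W, RB W = ν W * d W := ⟨_, fun _ => rfl⟩
  obtain ⟨GB, hGB⟩ : ∃ GB : Finset V → R, ∀ W, GB W = ν W * chainMix ∅ ent' ρ d d' W :=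
    ⟨_, fun _ => rfl⟩
  have hcd0 : ∀ W, 0 ≤ c W - d W := fun W => by linarith [hdc W]
  have hRA0 : ∀ W, 0 ≤ RA W := fun W => by
    rw [hRA]; exact mul_nonneg (hν0 W) (mul_nonneg (hθ0 W) (hcd0 W))
  have hRB0 : ∀ W, 0 ≤ RB W := fun W => by rw [hRB]; exact mul_nonneg (hν0 W) (hd0 W)
  have hGB0 : ∀ W, 0 ≤ GB W := fun W => by
    rw [hGB]; exact mul_nonneg (hν0 W) (chainMix_dd'_nonneg ent' ρ hρ0 hρ1 d d' hd0 hd'0 W)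
  have hGBle : ∀ W, GB W ≤ RB W := fun W => by
    rw [hGB, hRB]
    exact mul_le_mul_of_nonneg_left (chainMix_dd'_le ent' ρ hρ0 d d' hd'd W) (hν0 W)
  -- the pointwise decomposition
  have hdecR : ∀ W, ν W * chainMix ∅ ent' ρ c d W = RA W + RB W := by
    intro W; rw [hRA, hRB]; unfold chainMix; ring
  have hdecG : ∀ W, ν W * chainMix ∅ ent' ρ c d' W = RA W + GB W := by
    intro W; rw [hRA, hGB]; unfold chainMix; ring
  -- the sums of the goal in terms of the moments of the three laws
  have hs0 : ∑ W ∈ U.powerset, ν W * chainMix ∅ ent' ρ c d W =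
      (∑ W ∈ U.powerset, RA W) + ∑ W ∈ U.powerset, RB W := by
    rw [← Finset.sum_add_distrib]; exact Finset.sum_congr rfl fun W _ => hdecR W
  have hs1 : ∑ W ∈ U.powerset, ν W * chainMix ∅ ent' ρ c d W * (if m₁ ∈ W then (1 : R) else 0)
      = (∑ W ∈ U.powerset, RA W * (if m₁ ∈ W then (1 : R) else 0)) +
        ∑ W ∈ U.powerset, RB W * (if m₁ ∈ W then (1 : R) else 0) := by
    rw [← Finset.sum_add_distrib]
    exact Finset.sum_congr rfl fun W _ => by rw [hdecR W]; ring
  have hs2 : ∑ W ∈ U.powerset, ν W * chainMix ∅ ent' ρ c d W * (if m₂ ∈ W then (1 : R) else 0)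
      = (∑ W ∈ U.powerset, RA W * (if m₂ ∈ W then (1 : R) else 0)) +
        ∑ W ∈ U.powerset, RB W * (if m₂ ∈ W then (1 : R) else 0) := by
    rw [← Finset.sum_add_distrib]
    exact Finset.sum_congr rfl fun W _ => by rw [hdecR W]; ring
  have ht0 : ∑ W ∈ U.powerset, ν W * chainMix ∅ ent' ρ c d' W =
      (∑ W ∈ U.powerset, RA W) + ∑ W ∈ U.powerset, GB W := by
    rw [← Finset.sum_add_distrib]; exact Finset.sum_congr rfl fun W _ => hdecG W
  have ht1 : ∑ W ∈ U.powerset, ν W * chainMix ∅ ent' ρ c d' W * (if m₁ ∈ W then (1 : R) else 0)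
      = (∑ W ∈ U.powerset, RA W * (if m₁ ∈ W then (1 : R) else 0)) +
        ∑ W ∈ U.powerset, GB W * (if m₁ ∈ W then (1 : R) else 0) := by
    rw [← Finset.sum_add_distrib]
    exact Finset.sum_congr rfl fun W _ => by rw [hdecG W]; ring
  have ht2 : ∑ W ∈ U.powerset, ν W * chainMix ∅ ent' ρ c d' W * (if m₂ ∈ W then (1 : R) else 0)
      = (∑ W ∈ U.powerset, RA W * (if m₂ ∈ W then (1 : R) else 0)) +
        ∑ W ∈ U.powerset, GB W * (if m₂ ∈ W then (1 : R) else 0) := by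
    rw [← Finset.sum_add_distrib]
    exact Finset.sum_congr rfl fun W _ => by rw [hdecG W]; ring
  have ht12 : ∑ W ∈ U.powerset, ν W * chainMix ∅ ent' ρ c d' W *
      ((if m₁ ∈ W then (1 : R) else 0) * (if m₂ ∈ W then (1 : R) else 0))
      = (∑ W ∈ U.powerset, RA W * ((if m₁ ∈ W then (1 : R) else 0) *
          (if m₂ ∈ W then (1 : R) else 0))) +
        ∑ W ∈ U.powerset, GB W * ((if m₁ ∈ W then (1 : R) else 0) *
          (if m₂ ∈ W then (1 : R) else 0)) := by
    rw [← Finset.sum_add_distrib]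
    exact Finset.sum_congr rfl fun W _ => by rw [hdecG W]; ring
  rw [hs0, hs1, hs2, ht0, ht1, ht2, ht12]
  -- log-supermodularity of the three laws
  have hmix := mixture_lsm ∅ ent' ρ hρ0 hρ1 d d' hd0 hd'0 hd'd hdd hd'd' hdd' hratio''
  have hGBlsm : ∀ s ⊆ U, ∀ t ⊆ U, GB s * GB t ≤ GB (s ∩ t) * GB (s ∪ t) := by
    intro s hs t ht
    rw [hGB, hGB, hGB, hGB]
    calc ν s * chainMix ∅ ent' ρ d d' s * (ν t * chainMix ∅ ent' ρ d d' t)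
        = (ν s * ν t) * (chainMix ∅ ent' ρ d d' s * chainMix ∅ ent' ρ d d' t) := by ring
      _ ≤ (ν (s ∩ t) * ν (s ∪ t)) *
            (chainMix ∅ ent' ρ d d' (s ∩ t) * chainMix ∅ ent' ρ d d' (s ∪ t)) :=
          mul_le_mul (hν s hs t ht) (hmix s t)
            (mul_nonneg (chainMix_dd'_nonneg ent' ρ hρ0 hρ1 d d' hd0 hd'0 _)
              (chainMix_dd'_nonneg ent' ρ hρ0 hρ1 d d' hd0 hd'0 _))
            (mul_nonneg (hν0 _) (hν0 _))
      _ = _ := by ring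
  have hRBlsm : ∀ s ⊆ U, ∀ t ⊆ U, RB s * RB t ≤ RB (s ∩ t) * RB (s ∪ t) := by
    intro s hs t ht
    rw [hRB, hRB, hRB, hRB]
    calc ν s * d s * (ν t * d t) = (ν s * ν t) * (d s * d t) := by ring
      _ ≤ (ν (s ∩ t) * ν (s ∪ t)) * (d (s ∩ t) * d (s ∪ t)) :=
          mul_le_mul (hν s hs t ht) (hdd s t) (mul_nonneg (hd0 _) (hd0 _))
            (mul_nonneg (hν0 _) (hν0 _))
      _ = _ := by ring
  -- the Holley conditions A ≼ Ā-gate and A ≼ Ā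
  have hdomAG : ∀ s ⊆ U, ∀ t ⊆ U, RA s * GB t ≤ RA (s ∩ t) * GB (s ∪ t) := by
    intro s hs t ht
    rw [hRA, hRA, hGB, hGB]
    have hX := aw_cross_AG ent' ρ hρ0 hρ1 c d d' hc0 hd0 hd'0 hdc hd'd hcc hratio hratio' s t
    calc ν s * ((1 - chainTheta ∅ ent' ρ s) * (c s - d s)) * (ν t * chainMix ∅ ent' ρ d d' t)
        = (ν s * ν t) *
            ((1 - chainTheta ∅ ent' ρ s) * (c s - d s) * chainMix ∅ ent' ρ d d' t) := by ring
      _ ≤ (ν (s ∩ t) * ν (s ∪ t)) *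
            ((1 - chainTheta ∅ ent' ρ (s ∩ t)) * (c (s ∩ t) - d (s ∩ t)) *
              chainMix ∅ ent' ρ d d' (s ∪ t)) :=
          mul_le_mul (hν s hs t ht) hX
            (mul_nonneg (mul_nonneg (hθ0 _) (hcd0 _))
              (chainMix_dd'_nonneg ent' ρ hρ0 hρ1 d d' hd0 hd'0 _))
            (mul_nonneg (hν0 _) (hν0 _))
      _ = _ := by ring
  have hdomAR : ∀ s ⊆ U, ∀ t ⊆ U, RA s * RB t ≤ RA (s ∩ t) * RB (s ∪ t) := by
    intro s hs t ht
    rw [hRA, hRA, hRB, hRB]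
    have hX := aw_cross_AR ent' ρ hρ0 hρ1 c d hc0 hd0 hdc hcc hratio s t
    calc ν s * ((1 - chainTheta ∅ ent' ρ s) * (c s - d s)) * (ν t * d t)
        = (ν s * ν t) * ((1 - chainTheta ∅ ent' ρ s) * (c s - d s) * d t) := by ring
      _ ≤ (ν (s ∩ t) * ν (s ∪ t)) *
            ((1 - chainTheta ∅ ent' ρ (s ∩ t)) * (c (s ∩ t) - d (s ∩ t)) * d (s ∪ t)) :=
          mul_le_mul (hν s hs t ht) hX
            (mul_nonneg (mul_nonneg (hθ0 _) (hcd0 _)) (hd0 _)) (mul_nonneg (hν0 _) (hν0 _))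
      _ = _ := by ring
  -- the Ā-pair is an OR-tail pair
  have wML : ∀ s ⊆ U, ∀ t ⊆ U, (∃ r ∈ ent', r ∈ s) →
      GB s * RB t ≤ RB (s ∩ t) * GB (s ∪ t) := by
    intro s hs t ht hse
    rw [hGB, hGB, hRB, hRB]
    have hX := aw_cross_GR ent' ρ hρ0 hρ1 d d' hd0 hd'0 hdd hdd' s t hse
    calc ν s * chainMix ∅ ent' ρ d d' s * (ν t * d t)
        = (ν s * ν t) * (chainMix ∅ ent' ρ d d' s * d t) := by ring
      _ ≤ (ν (s ∩ t) * ν (s ∪ t)) * (d (s ∩ t) * chainMix ∅ ent' ρ d d' (s ∪ t)) :=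
          mul_le_mul (hν s hs t ht) hX
            (mul_nonneg (chainMix_dd'_nonneg ent' ρ hρ0 hρ1 d d' hd0 hd'0 _) (hd0 _))
            (mul_nonneg (hν0 _) (hν0 _))
      _ = _ := by ring
  have hI : ∀ W, W ∩ ent' = ∅ → GB W = RB W := by
    intro W hW
    have hno : ¬ ∃ r ∈ ent', r ∈ W := by
      rintro ⟨r, hr, hrW⟩
      have : r ∈ W ∩ ent' := Finset.mem_inter.mpr ⟨hrW, hr⟩
      rw [hW] at this
      exact Finset.notMem_empty r this
    rw [hGB, hRB]; unfold chainMix; rw [chainTheta_empty, if_neg hno]; ring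
  -- the four ingredients of (★)
  have hD' : (∑ W ∈ U.powerset, RA W * (if m₁ ∈ W then (1 : R) else 0)) *
      (∑ W ∈ U.powerset, RA W * (if m₂ ∈ W then (1 : R) else 0)) ≤
      (∑ W ∈ U.powerset, RA W) * (∑ W ∈ U.powerset, RA W *
        ((if m₁ ∈ W then (1 : R) else 0) * (if m₂ ∈ W then (1 : R) else 0))) := by
    have e : ∀ W, RA W = ν W * ((1 - chainTheta ∅ ent' ρ W) * (c W - d W)) := hRA
    simp only [e]; exact hD
  have hFG := aw_fkg_sums U GB (fun W => if m₁ ∈ W then (1 : R) else 0)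
    (fun W => if m₂ ∈ W then (1 : R) else 0) hGB0 hx0 hy0 hxm hym hGBlsm
  have hH1 := aw_holley_sums U RA GB (fun W => if m₁ ∈ W then (1 : R) else 0) hRA0 hGB0 hx0 hxm
    hdomAG
  have hH2 := aw_holley_sums U RA GB (fun W => if m₂ ∈ W then (1 : R) else 0) hRA0 hGB0 hy0 hym
    hdomAG
  have hK1 := aw_holley_sums U RA RB (fun W => if m₁ ∈ W then (1 : R) else 0) hRA0 hRB0 hx0 hxm
    hdomAR
  have hK2 := aw_holley_sums U RA RB (fun W => if m₂ ∈ W then (1 : R) else 0) hRA0 hRB0 hy0 hym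
    hdomAR
  have hT11 := gate_functional_nonneg U ent' RB GB (fun W => if m₁ ∈ W then (1 : R) else 0)
    (fun W => if m₂ ∈ W then (1 : R) else 0) hRB0 hGB0 hx0 hy0 hxm hym hRBlsm hGBlsm wML hI
  -- bounds of the moments
  have bnd : ∀ (F : Finset V → R), (∀ W, 0 ≤ F W) →
      0 ≤ ∑ W ∈ U.powerset, F W ∧
      0 ≤ ∑ W ∈ U.powerset, F W * (if m₁ ∈ W then (1 : R) else 0) ∧
      0 ≤ ∑ W ∈ U.powerset, F W * (if m₂ ∈ W then (1 : R) else 0) ∧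
      0 ≤ ∑ W ∈ U.powerset, F W * ((if m₁ ∈ W then (1 : R) else 0) *
        (if m₂ ∈ W then (1 : R) else 0)) ∧
      (∑ W ∈ U.powerset, F W * (if m₁ ∈ W then (1 : R) else 0)) ≤ ∑ W ∈ U.powerset, F W ∧
      (∑ W ∈ U.powerset, F W * (if m₂ ∈ W then (1 : R) else 0)) ≤ ∑ W ∈ U.powerset, F W ∧
      (∑ W ∈ U.powerset, F W * ((if m₁ ∈ W then (1 : R) else 0) *
        (if m₂ ∈ W then (1 : R) else 0))) ≤ ∑ W ∈ U.powerset, F W := by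
    intro F hF
    refine ⟨Finset.sum_nonneg fun W _ => hF W,
      Finset.sum_nonneg fun W _ => mul_nonneg (hF W) (hx0 W),
      Finset.sum_nonneg fun W _ => mul_nonneg (hF W) (hy0 W),
      Finset.sum_nonneg fun W _ => mul_nonneg (hF W) (mul_nonneg (hx0 W) (hy0 W)),
      Finset.sum_le_sum fun W _ => mul_le_of_le_one_right (hF W) (hx1 W),
      Finset.sum_le_sum fun W _ => mul_le_of_le_one_right (hF W) (hy1 W),
      Finset.sum_le_sum fun W _ =>
        mul_le_of_le_one_right (hF W) (mul_le_one₀ (hx1 W) (hy0 W) (hy1 W))⟩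
  obtain ⟨ha0, ha1, ha2, ha12, ha1le, ha2le, ha12le⟩ := bnd RA hRA0
  obtain ⟨hb0, hb1, hb2, -, hb1le, hb2le, -⟩ := bnd RB hRB0
  obtain ⟨hg0, hg1, hg2, hg12, hg1le, hg2le, hg12le⟩ := bnd GB hGB0
  have hgb : ∑ W ∈ U.powerset, GB W ≤ ∑ W ∈ U.powerset, RB W :=
    Finset.sum_le_sum fun W _ => hGBle W
  exact aw_assemble _ _ _ _ _ _ _ _ _ _ _ ha0 ha1 ha2 ha12 ha1le ha2le ha12le hb0 hb1 hb2 hb1le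
    hb2le hg0 hg1 hg2 hg12 hg1le hg2le hg12le hgb (by linarith [hD'])
    (aw_T01_nonneg _ _ _ _ _ _ _ hg0 hg1 hg2 hg12 hg1le hg2le hg12le hFG hH1 hH2) hT11
    (mul_nonneg_of_nonpos_of_nonpos (by linarith [hK1]) (by linarith [hK2]))

end ChainAWorldCov

end Summit.Ventures.PercRepro2.Coin
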